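import Mathlib
import Literature.Barriers.PneNP.CorrelationPolytopeXCLowerBoundGraph
import Literature.Barriers.PneNP.ExtendedFormulationLinearImage
import Literature.Barriers.PneNP.TSPExtensionComplexityHyperplaneBound
import Literature.Combinatorics.Optimization.CorPolytopeApproximateEFLowerBound
import Summits.ValiantsHypothesis.ValiantsHypothesis.Theorems.FifoMatchingNNDivisionHardCorSandwich
import Summits.ValiantsHypothesis.ValiantsHypothesis.Cruxes.NNLinearDegreeCofactorHard.Lines.xc_division
import HarnessLib

/-!
# `UdisjEnvelope` — THE UDISJ ENVELOPE: per-row-optimised shift certificates (val-idea-43 g4, W5-P1; crux stmt-ValiantsHypothesis-21181)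

Crux idea card `udisj-envelope` (lineage 39/43 «value-level certificates», R294 (4)), workfile.  VP ≠ VNP is NOT proved here;
21181 OPEN; COR-VIRTUAL OPEN.

THE LEVER.  Braun–Fiorini–Pokutta–Steurer 2012 Thm 5 is a statement about MATRICES, not about clique rows: every nonnegative
matrix `M` indexed by pairs of subsets of `[n]` with `M(a,b) = ρ` when `a ∩ b = ∅` and `M(a,b) = ρ − 1` when `|a ∩ b| = 1`
(a `ρ`-EXTENSION OF UDISJ; all other entries arbitrary `≥ 0`) has `rank₊ M ≥ 2^{Ω(n^{1−2β})}` for `ρ = O(n^β)`, `β < 1/2`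
(arXiv:1204.0957 pp. 11–13; Braverman–Moitra STOC 2013: up to `ρ = n^{1−ε}`).  The line of record `virtual_passenger` (class S
`Shallow`, KNOWN stub `CorSandwichHard` = BFPS Thm 6) feeds this engine ONE fixed row family, the clique rows
`u_a = 2·diag(𝟙_a) − 𝟙_a𝟙_aᵀ`.  But for a passenger `Q = conv{q_j}` and a base generator `q_{j₀}`, ANY family of functionals
`φ_a` (one per row `a ⊆ [h]`) with the UDISJ PATTERN on the vertices of `COR(K_h)` — `φ_a(bbᵀ) = 0` if `a ∩ b = ∅`, `= 1` if
`|a ∩ b| = 1`, values at `|a ∩ b| ≥ 2` FREE — that is valid with the UNIFORM bound `φ_a ≤ 1 + σ` on `R := COR(K_h) + Q − q_{j₀}`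
makes the slack matrix `S(a,b) := (1 + σ) − φ_a(bbᵀ)` a `(1+σ)`-extension of UDISJ with `rank₊ S ≤ xc(R) + 1` (Yannakakis /
Farkas, tree: `HasEFOfSize.exists_nonneg_factorization`).  The admissible `φ_a` form an AFFINE SPACE per row
(`diag(𝟙_a) + Σ_{i≠m∈a} γ_im E_im + antisymmetric`), so the best row is ONE LP PER ROW, chosen AFTER seeing `Q`:
CLASS U_σ `UdisjThin σ` := `∃ j₀ ∀ a ∃ φ_a` (pattern ∧ `φ_a(bbᵀ + q_j − q_{j₀}) ≤ 1 + σ ∀ b j`).  U ⊋ S ⊋ F (take `φ_a := u_a`),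
U ⊇ the stable-set rows `ι_a = diag(𝟙_a) − ½·𝟙_a𝟙_aᵀ|_{off}` (BPZ arXiv:1410.8816 Ex. 3.10), and U is decided at the line's
tolerance `σ(h) = ⌊⌊√h⌋^{1/2}⌋` modulo the MATRIX-LEVEL print theorem `UdisjShiftRankHard` (BFPS Thm 5, β = 1/4) —
`udisjThin_decided`, PROVED below with NO currency transport (the stub is about matrices, the class about passengers).
SEPARATION (crit-9 21:16:38Z admission test (a)): val-idea-39 g3's BLIND CUBE `Q♮` (`CliqueRowBlind.lean` rev 2/3: the clique-row
slack of `COR(n) + λ•Q♮` has `rank₊ ≤ 2n² + 3n + 2` for λ ≥ n − 1, ALL n — clique rows are BLIND; `Q♮` budgeted, `xc ≤ 2n`;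
`Q♮ ∉ S ∪ F`, `Q♮ ∉ K^hull_θ`) IS IN U_1: base `q_∅`, rows `φ_a = diag(𝟙_a) − c_a·(𝟙_a𝟙_aᵀ)|_{off}` with the INNER TILT
`c_a = (|a| − 2)/(2(|a| − 1))` instead of the clique row's `c = 1` (§3, `qNat_udisjThin` PROVED, axioms standard; `qNat_decided`): the per-row LP sees what the
fixed clique rows provably cannot.  For the DILATES `λ•Q♮` (λ ≥ h − 1 is 39's blindness range) the singleton rows `φ_{i} = x_ii`
of plain U are forced by the full pattern and climb by `λ`; the PINNED ENVELOPE `U^pin` (§5: rows `a ∋ z`, pattern only on columns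
`b ∌ z`, validity everywhere — a full shifted-UDISJ matrix of order `h − 1`) is decided modulo the SAME stub (`udisjThinPin_decided`,
`T c h ≤ T (c+1) (h−1)`) and contains `λ•Q♮` for EVERY `λ ≥ 0` (`smul_qNat_udisjThinPin`, `smul_qNat_decided`, PROVED).

CONTENTS (rev 6, all sorry-free, axioms standard): §1 `meet`, `UdisjPattern`, `UdisjThin`, KNOWN stub `UdisjShiftRankHard`;
§2 ★`udisjThin_decided_any` / `udisjThin_decided`; §3 ★`qNat_udisjThin` (Q♮ ∈ U₁), ★`qNat_decided`; §4 `cliqueRowG` (= line's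
`udRowG` verbatim), `cliqueRowG_dot_corVec` (= 2k − k²), ★`udisjThin_of_cliqueShallow` (S ⊆ U, F ⊆ U), `cliqueRowG_eq_tiltRow`,
`tiltRow_eq_cliqueRowG_add` (reconciliation: `φ_a = udRow_a + (1 − c_a)(𝟙_a𝟙_aᵀ)_off`); §5 `UdisjThinPin`, `UdisjThin.pin` (U ⊆ U^pin),
★`udisjThinPin_decided`, ★`smul_qNat_udisjThinPin` (λ•Q♮ ∈ U^pin_1 ∀ λ ≥ 0), ★`smul_qNat_decided`; §6 `cliqueRowG_dot_qNatG`
(= −|a|(|a|+|P|−2|a∩P|)), ★`qNat_not_cliqueShallow` (Q♮ ∉ S, h ≥ 24); §7 PORT KIT: `BFPS2012_udisjShiftRankHard` (Thm 5, matrix level,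
Literature-style PRIMITIVE fact), ★`corSandwichHard_of_bfps5` (port-3's Thm 6 fact DERIVED from it), ★`udisjShiftRankHard_of_bfps5` (§1 stub
DERIVED from it), `udisjThin_decided_of_bfps5`, `udisjThinPin_decided_of_bfps5`.
-/

set_option linter.dupNamespace false

namespace Summit.ValiantsHypothesis.ValiantsHypothesis.Cruxes.NNDivisionHard.UdisjEnvelope

open Matrix Finset
open scoped Pointwise
open Literature.Barriers.PneNP (HasEFOfSize)
open Literature.Combinatorics.Optimization (corPolytopeGraph corVec corVec_mem_corPolytopeGraph)
open Summit.ValiantsHypothesis.ValiantsHypothesis.Cruxes.NNLinearDegreeCofactorHard.XcDivision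
  (T corVec_top_apply dot_le_of_mem_convexHull udRow udPt udInd udMat udInd_apply ud_data)

variable {h : ℕ}

/-! ## §1 The class and the matrix-level print stub -/

/-- `|a ∩ supp b|`. -/
def meet (a : Finset (Fin h)) (b : Fin h → Bool) : ℕ := (a.filter fun i => b i = true).card

/-- **UDISJ pattern** of a functional `φ` on row `a`: `φ(bbᵀ) = 0` when `a ∩ b = ∅` and `φ(bbᵀ) = 1` when `|a ∩ b| = 1`
(values at `|a ∩ b| ≥ 2` are free). -/
def UdisjPattern (a : Finset (Fin h)) (φ : Fin h × Fin h → ℝ) : Prop :=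
  (∀ b : Fin h → Bool, meet a b = 0 → φ ⬝ᵥ corVec (⊤ : SimpleGraph (Fin h)) b = 0) ∧
  (∀ b : Fin h → Bool, meet a b = 1 → φ ⬝ᵥ corVec (⊤ : SimpleGraph (Fin h)) b = 1)

/-- **CLASS U_σ — UDISJ-THIN PASSENGERS (the UDISJ envelope).**  One base generator `q_{j₀}` and, for EVERY row `a ⊆ [h]`,
SOME UDISJ-patterned functional `φ_a` (chosen after seeing `Q`) valid with the uniform bound `1 + σ` on every vertex sum
`bbᵀ + q_j − q_{j₀}` (hence on `COR(K_h) + Q − q_{j₀}`). -/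
def UdisjThin (σ : ℝ) (h : ℕ) {J : Type} (q : J → (Fin h × Fin h → ℝ)) : Prop :=
  ∃ j₀ : J, ∀ a : Finset (Fin h), ∃ φ : Fin h × Fin h → ℝ, UdisjPattern a φ ∧
    ∀ (b : Fin h → Bool) (j : J), φ ⬝ᵥ (corVec (⊤ : SimpleGraph (Fin h)) b + q j - q j₀) ≤ 1 + σ

theorem UdisjThin.mono {σ σ' : ℝ} (hσ : σ ≤ σ') {J : Type} {q : J → (Fin h × Fin h → ℝ)}
    (hq : UdisjThin σ h q) : UdisjThin σ' h q := by
  obtain ⟨j₀, hj₀⟩ := hq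
  refine ⟨j₀, fun a => ?_⟩
  obtain ⟨φ, hφ, hv⟩ := hj₀ a
  exact ⟨φ, hφ, fun b j => le_trans (hv b j) (by linarith)⟩

/-- **KNOWN STUB (print theorem, MATRIX LEVEL; Literature port wanted) — NONNEGATIVE RANK OF SHIFTED UDISJ at
`ρ ≤ 1 + n^{1/4}`**: every nonnegative `ρ`-extension of UDISJ on `[n]` (rows = subsets `a`, columns = 0/1 vectors `b`;
`M(a,b) = ρ` if `a ∩ b = ∅`, `= ρ − 1` if `|a ∩ b| = 1`, other entries arbitrary `≥ 0`) that factors nonnegatively through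
`r + 1` slots has `T c n < r` eventually (print: `rank₊ M ≥ 2^{c'·n^{1/2}}`).  [cite: BraunFioriniPokuttaSteurer2012
«Approximation limits of linear programs (beyond hierarchies)», FOCS 2012 / Math. Oper. Res. 40 (2015), Thm 5 with β = 1/4
(from Razborov's rectangle corruption lemma, their Lemma 5) — arXiv:1204.0957 pp. 11–13 (materialised, read); range improved to
`ρ ≤ n^{1−ε}` by BravermanMoitra2013 STOC Thm 1 and Braun–Pokutta 2013 (common information).]  This is the statement INSIDE the
proof of BFPS Thm 6 (= the line's `CorSandwichHard` / port-3's `BFPS2012_corSandwichHard`, which feed it the clique rows only);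
size of a port: L (Razborov with explicit ε + the half-page covering argument p. 12). -/
def UdisjShiftRankHard : Prop :=
  ∀ c : ℕ, ∃ n₀ : ℕ, ∀ n ≥ n₀, ∀ ρ : ℝ, 1 ≤ ρ → ρ ≤ 1 + Nat.sqrt (Nat.sqrt n) →
    ∀ (M : Finset (Fin n) → (Fin n → Bool) → ℝ), (∀ a b, 0 ≤ M a b) →
    (∀ a b, meet a b = 0 → M a b = ρ) → (∀ a b, meet a b = 1 → M a b = ρ - 1) →
    ∀ (r : ℕ) (U : Finset (Fin n) → Option (Fin r) → ℝ) (V : (Fin n → Bool) → Option (Fin r) → ℝ),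
      (∀ a i, 0 ≤ U a i) → (∀ b i, 0 ≤ V b i) → (∀ a b, M a b = ∑ i, U a i * V b i) → T c n < r

/-! ## §2 ★ CLASS U IS DECIDED modulo the matrix-level stub (no currency transport) -/

/-- validity on the vertex sums gives validity on the whole translated body `COR(K_h) + Q − q_{j₀}`. -/
theorem valid_of_vertex_valid {J : Type} (q : J → (Fin h × Fin h → ℝ)) (j₀ : J) (φ : Fin h × Fin h → ℝ) (m : ℝ)
    (hval : ∀ (b : Fin h → Bool) (j : J), φ ⬝ᵥ (corVec (⊤ : SimpleGraph (Fin h)) b + q j - q j₀) ≤ m) :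
    ∀ x ∈ (fun x => x + -q j₀) '' (corPolytopeGraph (⊤ : SimpleGraph (Fin h)) + convexHull ℝ (Set.range q)),
      φ ⬝ᵥ x ≤ m := by
  rintro _ ⟨z, hz, rfl⟩
  obtain ⟨p, hp, y, hy, rfl⟩ := Set.mem_add.1 hz
  have hy' : ∀ b : Fin h → Bool, φ ⬝ᵥ (corVec (⊤ : SimpleGraph (Fin h)) b + y - q j₀) ≤ m := by
    intro b
    have : φ ⬝ᵥ y ≤ m - φ ⬝ᵥ (corVec (⊤ : SimpleGraph (Fin h)) b - q j₀) := by
      refine dot_le_of_mem_convexHull _ _ _ ?_ y hy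
      rintro _ ⟨j, rfl⟩
      have hj := hval b j
      rw [show corVec (⊤ : SimpleGraph (Fin h)) b + q j - q j₀ = q j + (corVec (⊤ : SimpleGraph (Fin h)) b - q j₀) by abel,
        dotProduct_add] at hj
      linarith
    rw [show corVec (⊤ : SimpleGraph (Fin h)) b + y - q j₀ = y + (corVec (⊤ : SimpleGraph (Fin h)) b - q j₀) by abel,
      dotProduct_add]
    linarith
  have hp' : φ ⬝ᵥ p ≤ m - φ ⬝ᵥ (y - q j₀) := by
    refine dot_le_of_mem_convexHull (Set.range (corVec (⊤ : SimpleGraph (Fin h)))) _ _ ?_ p hp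
    rintro _ ⟨b, rfl⟩
    have hb := hy' b
    rw [show corVec (⊤ : SimpleGraph (Fin h)) b + y - q j₀ = corVec (⊤ : SimpleGraph (Fin h)) b + (y - q j₀) by abel,
      dotProduct_add] at hb
    linarith
  show φ ⬝ᵥ (p + y + -q j₀) ≤ m
  rw [show p + y + -q j₀ = p + (y - q j₀) by abel, dotProduct_add]
  linarith

/-- ★ **CLASS U IS DECIDED modulo `UdisjShiftRankHard`**: UDISJ-thin passengers (at the line's tolerance `⌊⌊√h⌋^{1/2}⌋`) do not
make `COR(K_h) + Q` quasi-polynomially cheap.  Proof: translate the base generator to `0`; the chosen rows `φ_a ≤ 1 + σ` are valid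
on `R = COR + Q − q_{j₀}` and the vertices `bbᵀ` lie in `R`; Yannakakis' factorisation of the slacks `(1+σ) − φ_a(bbᵀ)` through
`r + 1` slots is a nonnegative factorisation of a `(1+σ)`-extension of UDISJ. -/
theorem udisjThin_decided_any (hU : UdisjShiftRankHard) :
    ∀ c : ℕ, ∃ h₀ : ℕ, ∀ h ≥ h₀, ∀ (J : Type) (q : J → (Fin h × Fin h → ℝ)) (r : ℕ),
      UdisjThin (Nat.sqrt (Nat.sqrt h)) h q →
      HasEFOfSize (corPolytopeGraph (⊤ : SimpleGraph (Fin h)) + convexHull ℝ (Set.range q)) r → T c h < r := by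
  classical
  intro c
  obtain ⟨n₀, hn₀⟩ := hU c
  refine ⟨n₀, fun h hh J q r hT hEF => ?_⟩
  obtain ⟨j₀, hj₀⟩ := hT
  choose φ hφ hval using hj₀
  set σ : ℝ := (Nat.sqrt (Nat.sqrt h) : ℝ) with hσ
  set R : Set (Fin h × Fin h → ℝ) :=
    (fun x => x + -q j₀) '' (corPolytopeGraph (⊤ : SimpleGraph (Fin h)) + convexHull ℝ (Set.range q)) with hRdef
  have hR : HasEFOfSize R r := hEF.image_add_const (-q j₀)
  have hv : ∀ b : Fin h → Bool, corVec (⊤ : SimpleGraph (Fin h)) b ∈ R := fun b =>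
    ⟨corVec (⊤ : SimpleGraph (Fin h)) b + q j₀,
      Set.add_mem_add (corVec_mem_corPolytopeGraph _ b) (subset_convexHull ℝ _ ⟨j₀, rfl⟩), by simp⟩
  have hvalid : ∀ a, ∀ x ∈ R, φ a ⬝ᵥ x ≤ 1 + σ := fun a => valid_of_vertex_valid q j₀ (φ a) (1 + σ) (hval a)
  obtain ⟨U, V, hU0, hV0, hfac⟩ :=
    Literature.Barriers.PneNP.HasEFOfSize.exists_nonneg_factorization hR
      (fun b : Fin h → Bool => corVec (⊤ : SimpleGraph (Fin h)) b) hv φ (fun _ => 1 + σ) hvalid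
  have hσ0 : (0 : ℝ) ≤ σ := Nat.cast_nonneg _
  refine hn₀ h hh (1 + σ) (by linarith) le_rfl (fun a b => 1 + σ - φ a ⬝ᵥ corVec (⊤ : SimpleGraph (Fin h)) b)
    ?_ ?_ ?_ r U V hU0 hV0 (fun a b => hfac a b)
  · intro a b; linarith [hvalid a _ (hv b)]
  · intro a b hab; rw [(hφ a).1 b hab, sub_zero]
  · intro a b hab; rw [(hφ a).2 b hab]

/-- ★ the line's shape (`q : Fin (K+1) → _`). -/
theorem udisjThin_decided (hU : UdisjShiftRankHard) :
    ∀ c : ℕ, ∃ h₀ : ℕ, ∀ h ≥ h₀, ∀ (K : ℕ) (q : Fin (K + 1) → (Fin h × Fin h → ℝ)) (r : ℕ),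
      UdisjThin (Nat.sqrt (Nat.sqrt h)) h q →
      HasEFOfSize (corPolytopeGraph (⊤ : SimpleGraph (Fin h)) + convexHull ℝ (Set.range q)) r → T c h < r := by
  intro c
  obtain ⟨h₀, hh₀⟩ := udisjThin_decided_any hU c
  exact ⟨h₀, fun h hh K q r hT hEF => hh₀ h hh _ q r hT hEF⟩

/-! ## §3 ★ SEPARATION: val-idea-39's blind cube `Q♮` is UDISJ-thin with `σ = 1` (crit-9 21:16:38Z admission test (a))

`Q♮ = conv{q_P : P ⊆ [h]}`, `(q_P)_ii = 2P_i − 1 − |P|`, `(q_P)_im = 1 − P_i − P_m` (`CliqueRowBlind.qNat`, flat there; graph currency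
here).  Rows: the INNER-TILTED clique rows `φ_a = diag(𝟙_a) + γ_a·(𝟙_a𝟙_aᵀ)_{off}` with `γ_a = −(|a|−2)/(2(|a|−1))` (`|a| ≥ 2`), `0` else;
base `q_∅`.  Identities: `φ_a(bbᵀ) = k + γ_a k(k−1)` (`k = |a ∩ b|`), `φ_a(q_P) = 2|a∩P| − |a| − |a||P| + γ_a (|a|−1)(|a| − 2|a∩P|)`. -/

/-- `[i ∈ P]` as a real. -/
noncomputable def ind (P : Finset (Fin h)) (i : Fin h) : ℝ := if i ∈ P then 1 else 0

/-- graph-currency copy of the blind-cube vertex `q_P`. -/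
noncomputable def qNatG (P : Finset (Fin h)) : Fin h × Fin h → ℝ := fun p =>
  if p.1 = p.2 then 2 * ind P p.1 - 1 - (P.card : ℝ) else 1 - ind P p.1 - ind P p.2

/-- the inner-tilted clique row `diag(𝟙_a) + γ·(𝟙_a𝟙_aᵀ)_{off}`. -/
noncomputable def tiltRow (a : Finset (Fin h)) (γ : ℝ) : Fin h × Fin h → ℝ := fun p =>
  if p.1 ∈ a ∧ p.2 ∈ a then (if p.1 = p.2 then 1 else γ) else 0

/-- the inner tilt `γ_a = −(|a|−2)/(2(|a|−1))` for `|a| ≥ 2`, `0` otherwise. -/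
noncomputable def tiltCoeff (a : Finset (Fin h)) : ℝ :=
  if 2 ≤ a.card then -(((a.card : ℝ) - 2) / (2 * ((a.card : ℝ) - 1))) else 0

/-- `[b i]` as a real. -/
noncomputable def bind (b : Fin h → Bool) (i : Fin h) : ℝ := if b i then 1 else 0

theorem bind_mul_self (b : Fin h → Bool) (i : Fin h) : bind b i * bind b i = bind b i := by
  unfold bind; split_ifs <;> norm_num

theorem meet_eq_sum (a : Finset (Fin h)) (b : Fin h → Bool) : (meet a b : ℝ) = ∑ i ∈ a, bind b i := by
  classical
  simp only [meet, bind, Finset.card_filter, Nat.cast_sum, Nat.cast_ite, Nat.cast_one, Nat.cast_zero]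

theorem sum_ind (a P : Finset (Fin h)) : ∑ i ∈ a, ind P i = ((a ∩ P).card : ℝ) := by
  classical
  simp only [ind]
  rw [Finset.sum_ite_mem, Finset.sum_const, nsmul_eq_mul, mul_one]

theorem tiltRow_dot (a : Finset (Fin h)) (γ : ℝ) (x : Fin h × Fin h → ℝ) :
    tiltRow a γ ⬝ᵥ x = ∑ i ∈ a, ∑ m ∈ a, (if i = m then 1 else γ) * x (i, m) := by
  classical
  have h1 : ∑ i ∈ a, ∑ m ∈ a, (if i = m then 1 else γ) * x (i, m)
      = ∑ i, ∑ m, tiltRow a γ (i, m) * x (i, m) := by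
    rw [← Finset.sum_subset (Finset.subset_univ a)]
    · refine Finset.sum_congr rfl fun i hi => ?_
      rw [← Finset.sum_subset (Finset.subset_univ a)]
      · exact Finset.sum_congr rfl fun m hm => by simp [tiltRow, hi, hm]
      · intro m _ hm; simp [tiltRow, hm]
    · intro i _ hi; exact Finset.sum_eq_zero fun m _ => by simp [tiltRow, hi]
  rw [h1, dotProduct, Fintype.sum_prod_type]

/-- `φ_a(bbᵀ) = k + γ·k(k−1)`, `k = |a ∩ b|`. -/
theorem tiltRow_dot_corVec (a : Finset (Fin h)) (γ : ℝ) (b : Fin h → Bool) :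
    tiltRow a γ ⬝ᵥ corVec (⊤ : SimpleGraph (Fin h)) b = meet a b + γ * (meet a b * (meet a b - 1)) := by
  classical
  rw [tiltRow_dot, meet_eq_sum]
  have hcv : ∀ i m : Fin h, corVec (⊤ : SimpleGraph (Fin h)) b (i, m) = bind b i * bind b m :=
    fun i m => by rw [corVec_top_apply]; rfl
  simp_rw [hcv]
  have key : ∀ i ∈ a, ∑ m ∈ a, (if i = m then (1:ℝ) else γ) * (bind b i * bind b m)
      = (1 - γ) * bind b i + γ * (bind b i * ∑ m ∈ a, bind b m) := by
    intro i hi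
    rw [Finset.mul_sum, ← Finset.add_sum_erase a _ hi,
      ← Finset.add_sum_erase a (fun m => bind b i * bind b m) hi, if_pos rfl, bind_mul_self, one_mul]
    have : ∑ m ∈ a.erase i, (if i = m then (1:ℝ) else γ) * (bind b i * bind b m)
        = ∑ m ∈ a.erase i, γ * (bind b i * bind b m) :=
      Finset.sum_congr rfl fun m hm => by rw [if_neg (Finset.ne_of_mem_erase hm).symm]
    rw [this, ← Finset.mul_sum, mul_add]
    ring
  rw [Finset.sum_congr rfl key, Finset.sum_add_distrib, ← Finset.mul_sum, ← Finset.mul_sum, ← Finset.sum_mul]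
  ring

/-- `φ_a(q_P) = 2|a∩P| − |a| − |a||P| + γ·(|a|−1)(|a| − 2|a∩P|)`. -/
theorem tiltRow_dot_qNatG (a P : Finset (Fin h)) (γ : ℝ) :
    tiltRow a γ ⬝ᵥ qNatG P = 2 * ((a ∩ P).card : ℝ) - a.card - a.card * P.card
      + γ * (((a.card : ℝ) - 1) * (a.card - 2 * ((a ∩ P).card : ℝ))) := by
  classical
  rw [tiltRow_dot, ← sum_ind]
  have key : ∀ i ∈ a, ∑ m ∈ a, (if i = m then (1:ℝ) else γ) * qNatG P (i, m)
      = (-1 - P.card + γ * (((a.card : ℝ) - 1) - ∑ m ∈ a, ind P m)) + (2 - γ * ((a.card : ℝ) - 2)) * ind P i := by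
    intro i hi
    have hcard : ((a.erase i).card : ℝ) = a.card - 1 := by
      rw [Finset.card_erase_of_mem hi, Nat.cast_sub (Finset.card_pos.2 ⟨i, hi⟩), Nat.cast_one]
    have hdiag : (if i = i then (1:ℝ) else γ) * qNatG P (i, i) = 2 * ind P i - 1 - P.card := by
      rw [if_pos rfl, one_mul]; simp [qNatG]
    have hoff : ∀ m ∈ a.erase i, (if i = m then (1:ℝ) else γ) * qNatG P (i, m) = γ * (1 - ind P i - ind P m) := by
      intro m hm
      have him : i ≠ m := (Finset.ne_of_mem_erase hm).symm
      rw [if_neg him]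
      simp [qNatG, him]
    rw [← Finset.add_sum_erase a _ hi, hdiag, Finset.sum_congr rfl hoff, ← Finset.mul_sum, Finset.sum_sub_distrib,
      Finset.sum_sub_distrib, Finset.sum_const, Finset.sum_const, nsmul_eq_mul, nsmul_eq_mul,
      Finset.sum_erase_eq_sub hi, hcard]
    ring
  have hsum : ∀ C D : ℝ, ∑ i ∈ a, (C + D * ind P i) = a.card * C + D * ∑ i ∈ a, ind P i := by
    intro C D; rw [Finset.sum_add_distrib, Finset.sum_const, nsmul_eq_mul, Finset.mul_sum]
  rw [Finset.sum_congr rfl key, hsum]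
  ring

theorem tiltRow_pattern (a : Finset (Fin h)) (γ : ℝ) : UdisjPattern a (tiltRow a γ) := by
  refine ⟨fun b hb => ?_, fun b hb => ?_⟩
  · rw [tiltRow_dot_corVec, hb]; simp
  · rw [tiltRow_dot_corVec, hb]; simp

/-- the clique-row side: `k + γ_a k(k−1) ≤ 2` for `k ≤ |a|`, `|a| ≥ 2`. -/
theorem cor_side_le (s k : ℕ) (hs : 2 ≤ s) (hk : k ≤ s) :
    (k : ℝ) + -(((s : ℝ) - 2) / (2 * ((s : ℝ) - 1))) * ((k : ℝ) * ((k : ℝ) - 1)) ≤ 2 := by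
  have hs' : (2 : ℝ) ≤ s := by exact_mod_cast hs
  have hc0 : 0 ≤ ((s : ℝ) - 2) / (2 * ((s : ℝ) - 1)) := div_nonneg (by linarith) (by linarith)
  rcases Nat.lt_or_ge k 3 with hlt | hge
  · have hk2 : (k : ℝ) ≤ 2 := by exact_mod_cast Nat.lt_succ_iff.mp hlt
    have hkk : 0 ≤ (k : ℝ) * ((k : ℝ) - 1) := by
      rcases Nat.eq_zero_or_pos k with h0 | hpos
      · subst h0; simp
      · have : (1 : ℝ) ≤ k := by exact_mod_cast hpos
        exact mul_nonneg (by linarith) (by linarith)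
    nlinarith [mul_nonneg hc0 hkk]
  · have hk3 : (3 : ℝ) ≤ k := by exact_mod_cast hge
    have hks : (k : ℝ) ≤ s := by exact_mod_cast hk
    have hs1 : 0 < 2 * ((s : ℝ) - 1) := by linarith
    -- `c ≥ 1/4` and `k(k−1) ≥ 4(k−2)`
    have hc4 : 1 / 4 ≤ ((s : ℝ) - 2) / (2 * ((s : ℝ) - 1)) := by
      rw [le_div_iff₀ hs1]; linarith
    have hkk : 4 * ((k : ℝ) - 2) ≤ (k : ℝ) * ((k : ℝ) - 1) := by nlinarith
    have hkk0 : 0 ≤ (k : ℝ) - 2 := by linarith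
    nlinarith [mul_le_mul hc4 hkk (by linarith) hc0]

/-- ★ **`Q♮ ∈ U₁`**: the blind cube is UDISJ-thin with `σ = 1` (base `q_∅`, inner-tilted rows). -/
theorem qNat_udisjThin (h : ℕ) : UdisjThin 1 h (fun P : Finset (Fin h) => qNatG P) := by
  classical
  refine ⟨∅, fun a => ⟨tiltRow a (tiltCoeff a), tiltRow_pattern a _, fun b P => ?_⟩⟩
  rw [add_sub_assoc, dotProduct_add, dotProduct_sub, tiltRow_dot_corVec, tiltRow_dot_qNatG, tiltRow_dot_qNatG,
    Finset.inter_empty, Finset.card_empty, Nat.cast_zero]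
  have hk : (meet a b : ℝ) ≤ a.card := by exact_mod_cast Finset.card_filter_le _ _
  have ht₁ : ((a ∩ P).card : ℝ) ≤ P.card := by exact_mod_cast Finset.card_le_card Finset.inter_subset_right
  have ht₂ : ((a ∩ P).card : ℝ) ≤ a.card := by exact_mod_cast Finset.card_le_card Finset.inter_subset_left
  have hk0 : (0 : ℝ) ≤ meet a b := Nat.cast_nonneg _
  have ht0 : (0 : ℝ) ≤ (a ∩ P).card := Nat.cast_nonneg _
  have hp0 : (0 : ℝ) ≤ P.card := Nat.cast_nonneg _
  by_cases hs : 2 ≤ a.card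
  · have hs' : (2 : ℝ) ≤ a.card := by exact_mod_cast hs
    have hγ : tiltCoeff a * ((a.card : ℝ) - 1) = -(((a.card : ℝ) - 2) / 2) := by
      unfold tiltCoeff; rw [if_pos hs]
      have : (a.card : ℝ) - 1 ≠ 0 := by linarith
      field_simp
    have hL1 : (meet a b : ℝ) + tiltCoeff a * ((meet a b : ℝ) * ((meet a b : ℝ) - 1)) ≤ 2 := by
      unfold tiltCoeff; rw [if_pos hs]
      exact cor_side_le a.card (meet a b) hs (Finset.card_filter_le _ _)
    have h3 : tiltCoeff a * (((a.card : ℝ) - 1) * (a.card - 2 * ((a ∩ P).card : ℝ)))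
        - tiltCoeff a * (((a.card : ℝ) - 1) * (a.card - 2 * (0 : ℝ))) = ((a.card : ℝ) - 2) * ((a ∩ P).card : ℝ) := by
      linear_combination (-2 * ((a ∩ P).card : ℝ)) * hγ
    have h4 : (a.card : ℝ) * ((a ∩ P).card : ℝ) ≤ (a.card : ℝ) * P.card :=
      mul_le_mul_of_nonneg_left ht₁ (by linarith)
    nlinarith [hL1, h3, h4]
  · have hγ0 : tiltCoeff a = 0 := by unfold tiltCoeff; rw [if_neg hs]
    rw [hγ0]
    have hs1 : a.card ≤ 1 := by omega
    rcases Nat.le_one_iff_eq_zero_or_eq_one.mp hs1 with h0 | h1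
    · have hk' : (meet a b : ℝ) ≤ 0 := by rw [h0] at hk; exact_mod_cast hk
      have ht' : ((a ∩ P).card : ℝ) ≤ 0 := by rw [h0] at ht₂; exact_mod_cast ht₂
      rw [h0]; push_cast; nlinarith
    · have hk' : (meet a b : ℝ) ≤ 1 := by rw [h1] at hk; exact_mod_cast hk
      have ht' : ((a ∩ P).card : ℝ) ≤ 1 := by rw [h1] at ht₂; exact_mod_cast ht₂
      rw [h1]; push_cast; nlinarith

/-- ★ **the blind cube is DECIDED modulo the matrix-level stub** (for `h ≥ 1`, where `1 ≤ ⌊⌊√h⌋^{1/2}⌋`): `COR(K_h) + Q♮` is not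
quasi-polynomially cheap — seen by the UDISJ envelope although every FIXED clique-row certificate is blind on `λ•Q♮` (val-idea-39 g3). -/
theorem qNat_decided (hU : UdisjShiftRankHard) :
    ∀ c : ℕ, ∃ h₀ : ℕ, ∀ h ≥ h₀, ∀ r : ℕ,
      HasEFOfSize (corPolytopeGraph (⊤ : SimpleGraph (Fin h)) +
        convexHull ℝ (Set.range fun P : Finset (Fin h) => qNatG P)) r → T c h < r := by
  intro c
  obtain ⟨h₀, hh₀⟩ := udisjThin_decided_any hU c
  refine ⟨max h₀ 1, fun h hh r hEF => hh₀ h (le_trans (le_max_left _ _) hh) _ _ r ?_ hEF⟩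
  refine (qNat_udisjThin h).mono ?_
  have h1 : 1 ≤ h := le_trans (le_max_right _ _) hh
  have : 1 ≤ Nat.sqrt (Nat.sqrt h) := by
    rw [Nat.le_sqrt, Nat.le_sqrt]; simpa using h1
  exact_mod_cast this

/-! ## §4 S ⊆ U in the kernel: clique rows are UDISJ-pattern rows of COR-value `2k − k² ≤ 1`

`cliqueRowG a` below has the SAME BODY as the line's `VirtualPassenger.udRowG a` (`fun ij => udRow a (finProdFinEquiv ij)`), so in the line
`Shallow h q → UdisjThin ⌊⌊√h⌋^{1/2}⌋ h q` and `CommonExtremiser h q → UdisjThin 0 h q` are `udisjThin_of_cliqueShallow q _ ‹_›` (δ-unfolding);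
the line module itself is not importable here (`remote:stale:unbuilt`), hence the verbatim copy. -/

/-- verbatim copy of `VirtualPassenger.udRowG`: the clique row `2·diag(𝟙_a) − 𝟙_a𝟙_aᵀ` in graph currency. -/
noncomputable def cliqueRowG (a : Finset (Fin h)) : Fin h × Fin h → ℝ := fun ij => udRow a (finProdFinEquiv ij)

theorem udRow_dotProduct_funCongrLeft (a : Finset (Fin h)) (x : Fin h × Fin h → ℝ) :
    udRow a ⬝ᵥ (LinearEquiv.funCongrLeft ℝ ℝ (finProdFinEquiv (m := h) (n := h)).symm x) = cliqueRowG a ⬝ᵥ x := by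
  unfold cliqueRowG dotProduct
  rw [← (finProdFinEquiv (m := h) (n := h)).sum_comp]
  refine Finset.sum_congr rfl fun ij _ => ?_
  simp [LinearEquiv.funCongrLeft_apply, LinearMap.funLeft_apply]

/-- `udRowG_a(bbᵀ) = 2k − k²` (`k = |a ∩ supp b|`): transport of `ud_data`'s slack identity `1 − udRow a·udPt b = (1 − k)²`. -/
theorem cliqueRowG_dot_corVec (a : Finset (Fin h)) (b : Fin h → Bool) :
    cliqueRowG a ⬝ᵥ corVec (⊤ : SimpleGraph (Fin h)) b = 2 * (meet a b : ℝ) - (meet a b : ℝ) ^ 2 := by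
  classical
  rw [← udRow_dotProduct_funCongrLeft, Literature.Barriers.PneNP.funCongrLeft_corVec_top]
  set P : Finset (Fin h) := Finset.univ.filter fun i => b i = true with hP
  have hvec : Literature.Combinatorics.Optimization.FixedSizePsdRank.vecOuter h
      (Literature.Combinatorics.Optimization.FixedSizePsdRank.bvec b) = udPt P := by
    unfold udPt udInd
    congr 1
    funext i
    simp [Literature.Combinatorics.Optimization.FixedSizePsdRank.bvec, hP]
  have hmeet : ((a ∩ P).card : ℝ) = meet a b := by
    rw [hP, Finset.inter_filter, Finset.inter_univ]; rfl
  have hslack := (ud_data h).2.2.1 a P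
  rw [hvec, ← hmeet]
  nlinarith [hslack]

theorem cliqueRowG_pattern (a : Finset (Fin h)) : UdisjPattern a (cliqueRowG a) := by
  refine ⟨fun b hb => ?_, fun b hb => ?_⟩
  · rw [cliqueRowG_dot_corVec, hb]; norm_num
  · rw [cliqueRowG_dot_corVec, hb]; norm_num

theorem cliqueRowG_dot_corVec_le_one (a : Finset (Fin h)) (b : Fin h → Bool) :
    cliqueRowG a ⬝ᵥ corVec (⊤ : SimpleGraph (Fin h)) b ≤ 1 := by
  rw [cliqueRowG_dot_corVec]; nlinarith [sq_nonneg ((meet a b : ℝ) - 1)]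

/-- ★ **S ⊆ U** (and F ⊆ U with `t = 0`): a family on which one generator is within `t` of the maximum of every clique row is UDISJ-thin with
tolerance `t` — take `φ_a =` the clique row itself. -/
theorem udisjThin_of_cliqueShallow {J : Type} (q : J → (Fin h × Fin h → ℝ)) (t : ℝ)
    (hS : ∃ j₀ : J, ∀ (a : Finset (Fin h)) (j : J), cliqueRowG a ⬝ᵥ q j ≤ cliqueRowG a ⬝ᵥ q j₀ + t) :
    UdisjThin t h q := by
  obtain ⟨j₀, hj₀⟩ := hS
  refine ⟨j₀, fun a => ⟨cliqueRowG a, cliqueRowG_pattern a, fun b j => ?_⟩⟩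
  rw [add_sub_assoc, dotProduct_add, dotProduct_sub]
  have h1 := cliqueRowG_dot_corVec_le_one a b
  have h2 := hj₀ a j
  linarith

set_option linter.unnecessarySeqFocus false in
/-- RECONCILIATION 39 ↔ 43 (crit-9 V#32): the clique row IS the inner-tilted row with tilt `−1` (`udMat a` has diagonal `2·1 − 1 = 1`), so
`φ_a = tiltRow a (−c_a) = udRow_a + (1 − c_a)·(𝟙_a𝟙_aᵀ)_{off}` — an entry-tilted clique row with uniform nonnegative off-diagonal tilt
`1 − c_a = |a|/(2(|a|−1)) ∈ (½, 1]`, no rescaling. -/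
theorem cliqueRowG_eq_tiltRow (a : Finset (Fin h)) : cliqueRowG a = tiltRow a (-1) := by
  funext p
  obtain ⟨i, m⟩ := p
  simp only [cliqueRowG, udRow, Literature.Combinatorics.Optimization.FixedSizePsdRank.flat, Equiv.symm_apply_apply, udMat,
    udInd_apply, tiltRow]
  by_cases hi : i ∈ a <;> by_cases hm : m ∈ a <;> by_cases him : i = m <;> simp_all <;> norm_num

/-- the off-diagonal block indicator `(𝟙_a𝟙_aᵀ)_{off}`. -/
noncomputable def offBlock (a : Finset (Fin h)) : Fin h × Fin h → ℝ := fun p =>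
  if p.1 ∈ a ∧ p.2 ∈ a ∧ p.1 ≠ p.2 then 1 else 0

theorem tiltRow_eq_cliqueRowG_add (a : Finset (Fin h)) (γ : ℝ) : tiltRow a γ = cliqueRowG a + (1 + γ) • offBlock a := by
  rw [cliqueRowG_eq_tiltRow]
  funext p
  obtain ⟨i, m⟩ := p
  simp only [tiltRow, offBlock, Pi.add_apply, Pi.smul_apply, smul_eq_mul]
  by_cases hi : i ∈ a <;> by_cases hm : m ∈ a <;> by_cases him : i = m <;> simp_all

/-! ## §5 ★ the PINNED envelope `U^pin` (crit-9 V#32 price P-P1e): decided modulo the SAME stub at order `h − 1`; ALL dilates `λ•Q♮ ∈ U^pin_1`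

Pin a coordinate `z`.  Rows `a ∋ z` need a functional VALID (`≤ 1+σ`) on all of `COR(K_h) + Q − q_{j₀}` but UDISJ-patterned only on the
columns `b ∌ z`; the slack sub-matrix (rows `a ∋ z`) × (columns `b ∌ z`) is then a full `(1+σ)`-shifted UDISJ matrix of ORDER `h − 1`
(`a ↦ a ∖ z`), so BFPS Thm 5 at order `h−1` and `T c h ≤ T (c+1) (h−1)` decide the class.  The plain-U obstruction for `λ•Q♮`, `λ ≥ h−1`
(singleton rows `a = {i}` are FORCED to `x_ii` by the full pattern and climb `λ`) dissolves: the pinned row `{z,i}` may use `x_ii + x_zz`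
(`x_zz` is pattern-free on columns `∌ z`; COR-value `≤ 1 + b_z ≤ 2`; `Q♮`-spread `2(P_i + P_z − |P|) ≤ 0`), and every other pinned row uses the
inner-tilted row of `a ∖ z` (spread `|a∖z|(|(a∖z)∩P| − |P|) ≤ 0`): base `q_∅`, spreads `≤ 0`, hence `λ`-proof. -/

/-- pinned UDISJ pattern: prescribed only on the columns avoiding the pin `z`. -/
def UdisjPatternPin (z : Fin h) (a : Finset (Fin h)) (φ : Fin h × Fin h → ℝ) : Prop :=
  (∀ b : Fin h → Bool, b z = false → meet a b = 0 → φ ⬝ᵥ corVec (⊤ : SimpleGraph (Fin h)) b = 0) ∧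
    ∀ b : Fin h → Bool, b z = false → meet a b = 1 → φ ⬝ᵥ corVec (⊤ : SimpleGraph (Fin h)) b = 1

/-- **CLASS U^pin_σ** — a pin `z` and a base `j₀`; every row `a ∋ z` has a functional valid (`≤ 1+σ`) on the vertex sums of
`COR(K_h) + Q − q_{j₀}` and UDISJ-patterned on the columns `b ∌ z`. -/
def UdisjThinPin (σ : ℝ) (h : ℕ) {J : Type} (q : J → (Fin h × Fin h → ℝ)) : Prop :=
  ∃ (z : Fin h) (j₀ : J), ∀ a : Finset (Fin h), z ∈ a → ∃ φ : Fin h × Fin h → ℝ, UdisjPatternPin z a φ ∧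
    ∀ (b : Fin h → Bool) (j : J), φ ⬝ᵥ (corVec (⊤ : SimpleGraph (Fin h)) b + q j - q j₀) ≤ 1 + σ

/-- `U_σ ⊆ U^pin_σ` (any pin). -/
theorem UdisjThin.pin {σ : ℝ} {J : Type} {q : J → (Fin h × Fin h → ℝ)} (z : Fin h) (hT : UdisjThin σ h q) :
    UdisjThinPin σ h q := by
  obtain ⟨j₀, hj₀⟩ := hT
  refine ⟨z, j₀, fun a _ => ?_⟩
  obtain ⟨φ, hφ, hval⟩ := hj₀ a
  exact ⟨φ, ⟨fun b _ hb => hφ.1 b hb, fun b _ hb => hφ.2 b hb⟩, hval⟩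

/-- row embedding `a' ↦ {z} ∪ succAbove_z(a')` of the order-`n` UDISJ matrix into the pinned rows. -/
def pinRow {n : ℕ} (z : Fin (n + 1)) (a' : Finset (Fin n)) : Finset (Fin (n + 1)) :=
  insert z (a'.map ⟨z.succAbove, Fin.succAbove_right_injective⟩)

/-- column embedding `b' ↦ (b' with a `0` inserted at `z`)`. -/
def pinCol {n : ℕ} (z : Fin (n + 1)) (b' : Fin n → Bool) : Fin (n + 1) → Bool := Fin.insertNth z false b'

theorem pinCol_same {n : ℕ} (z : Fin (n + 1)) (b' : Fin n → Bool) : pinCol z b' z = false := by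
  simp [pinCol]

theorem pinCol_succAbove {n : ℕ} (z : Fin (n + 1)) (b' : Fin n → Bool) (j : Fin n) : pinCol z b' (z.succAbove j) = b' j := by
  simp [pinCol]

theorem mem_pinRow {n : ℕ} (z : Fin (n + 1)) (a' : Finset (Fin n)) : z ∈ pinRow z a' := Finset.mem_insert_self _ _

/-- the pinned meets ARE the order-`n` meets. -/
theorem meet_pinRow_pinCol {n : ℕ} (z : Fin (n + 1)) (a' : Finset (Fin n)) (b' : Fin n → Bool) :
    meet (pinRow z a') (pinCol z b') = meet a' b' := by
  classical
  unfold meet pinRow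
  rw [Finset.filter_insert, if_neg (by rw [pinCol_same]; exact Bool.false_ne_true), Finset.filter_map, Finset.card_map]
  congr 1
  refine Finset.filter_congr fun j _ => ?_
  simp [pinCol_succAbove]

/-- the budget threshold moves by one level under `h ↦ h − 1`. -/
theorem T_succ_le (c n : ℕ) (hn : 1 ≤ n) : T c (n + 1) ≤ T (c + 1) n := by
  have hlog : Nat.log 2 (n + 1) ≤ Nat.log 2 n + 1 := by
    calc Nat.log 2 (n + 1) ≤ Nat.log 2 (n * 2) := Nat.log_mono_right (by omega)
      _ = Nat.log 2 n + 1 := Nat.log_mul_base (by norm_num) (by omega)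
  show 2 ^ ((Nat.log 2 (n + 1) + c) ^ c) ≤ 2 ^ ((Nat.log 2 n + (c + 1)) ^ (c + 1))
  apply Nat.pow_le_pow_right (by norm_num)
  calc (Nat.log 2 (n + 1) + c) ^ c ≤ (Nat.log 2 n + (c + 1)) ^ c := Nat.pow_le_pow_left (by omega) c
    _ ≤ (Nat.log 2 n + (c + 1)) ^ (c + 1) := Nat.pow_le_pow_right (by omega) (by omega)

/-- ★ **CLASS U^pin IS DECIDED modulo `UdisjShiftRankHard`** (tolerance `⌊⌊√(h−1)⌋^{1/2}⌋`, stated at `h = n + 1`). -/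
theorem udisjThinPin_decided (hU : UdisjShiftRankHard) :
    ∀ c : ℕ, ∃ n₀ : ℕ, ∀ n ≥ n₀, ∀ (J : Type) (q : J → (Fin (n + 1) × Fin (n + 1) → ℝ)) (r : ℕ),
      UdisjThinPin (Nat.sqrt (Nat.sqrt n)) (n + 1) q →
      HasEFOfSize (corPolytopeGraph (⊤ : SimpleGraph (Fin (n + 1))) + convexHull ℝ (Set.range q)) r →
      T c (n + 1) < r := by
  classical
  intro c
  obtain ⟨n₀, hn₀⟩ := hU (c + 1)
  refine ⟨max n₀ 1, fun n hn J q r hT hEF => ?_⟩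
  have hn₀' : n₀ ≤ n := le_trans (le_max_left _ _) hn
  have hn1 : 1 ≤ n := le_trans (le_max_right _ _) hn
  obtain ⟨z, j₀, hrows⟩ := hT
  have hrow : ∀ a' : Finset (Fin n), ∃ φ : Fin (n + 1) × Fin (n + 1) → ℝ, UdisjPatternPin z (pinRow z a') φ ∧
      ∀ (b : Fin (n + 1) → Bool) (j : J),
        φ ⬝ᵥ (corVec (⊤ : SimpleGraph (Fin (n + 1))) b + q j - q j₀) ≤ 1 + (Nat.sqrt (Nat.sqrt n) : ℝ) :=
    fun a' => hrows _ (mem_pinRow z a')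
  choose φ hφ hval using hrow
  set σ : ℝ := (Nat.sqrt (Nat.sqrt n) : ℝ) with hσ
  set R : Set (Fin (n + 1) × Fin (n + 1) → ℝ) :=
    (fun x => x + -q j₀) '' (corPolytopeGraph (⊤ : SimpleGraph (Fin (n + 1))) + convexHull ℝ (Set.range q)) with hRdef
  have hR : HasEFOfSize R r := hEF.image_add_const (-q j₀)
  have hv : ∀ b' : Fin n → Bool, corVec (⊤ : SimpleGraph (Fin (n + 1))) (pinCol z b') ∈ R := fun b' =>
    ⟨corVec (⊤ : SimpleGraph (Fin (n + 1))) (pinCol z b') + q j₀,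
      Set.add_mem_add (corVec_mem_corPolytopeGraph _ _) (subset_convexHull ℝ _ ⟨j₀, rfl⟩), by simp⟩
  have hvalid : ∀ a', ∀ x ∈ R, φ a' ⬝ᵥ x ≤ 1 + σ := fun a' => valid_of_vertex_valid q j₀ (φ a') (1 + σ) (hval a')
  obtain ⟨U, V, hU0, hV0, hfac⟩ :=
    Literature.Barriers.PneNP.HasEFOfSize.exists_nonneg_factorization hR
      (fun b' : Fin n → Bool => corVec (⊤ : SimpleGraph (Fin (n + 1))) (pinCol z b')) hv φ (fun _ => 1 + σ) hvalid
  have hσ0 : (0 : ℝ) ≤ σ := Nat.cast_nonneg _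
  have hlt : T (c + 1) n < r := by
    refine hn₀ n hn₀' (1 + σ) (by linarith) le_rfl
      (fun a' b' => 1 + σ - φ a' ⬝ᵥ corVec (⊤ : SimpleGraph (Fin (n + 1))) (pinCol z b')) ?_ ?_ ?_ r U V hU0 hV0
      (fun a' b' => hfac a' b')
    · intro a' b'; linarith [hvalid a' _ (hv b')]
    · intro a' b' hab
      rw [(hφ a').1 (pinCol z b') (pinCol_same z b') (by rw [meet_pinRow_pinCol]; exact hab), sub_zero]
    · intro a' b' hab
      rw [(hφ a').2 (pinCol z b') (pinCol_same z b') (by rw [meet_pinRow_pinCol]; exact hab)]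
  exact lt_of_le_of_lt (T_succ_le c n hn1) hlt

/-! ### all dilates `λ•Q♮` are in `U^pin_1` -/

theorem meet_erase_of_eq_false (a : Finset (Fin h)) (z : Fin h) (b : Fin h → Bool) (hb : b z = false) :
    meet (a.erase z) b = meet a b := by
  classical
  unfold meet
  rw [Finset.filter_erase, Finset.erase_eq_self.2 (by simp [hb])]

theorem meet_singleton_of_eq_false (z : Fin h) (b : Fin h → Bool) (hb : b z = false) :
    meet ({z} : Finset (Fin h)) b = 0 := by
  classical
  unfold meet
  rw [Finset.filter_singleton, if_neg (by simp [hb]), Finset.card_empty]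

theorem tilt_cor_le_two (a : Finset (Fin h)) (b : Fin h → Bool) :
    tiltRow a (tiltCoeff a) ⬝ᵥ corVec (⊤ : SimpleGraph (Fin h)) b ≤ 2 := by
  rw [tiltRow_dot_corVec]
  unfold tiltCoeff
  split_ifs with hs
  · exact cor_side_le a.card (meet a b) hs (Finset.card_filter_le _ _)
  · simp only [zero_mul, add_zero]
    have : meet a b ≤ 1 := le_trans (Finset.card_filter_le _ _) (by omega)
    exact_mod_cast (by omega : meet a b ≤ 2)

theorem tilt_cor_le_one (a : Finset (Fin h)) (b : Fin h → Bool) (hs : ¬ 2 ≤ a.card) :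
    tiltRow a (tiltCoeff a) ⬝ᵥ corVec (⊤ : SimpleGraph (Fin h)) b ≤ 1 := by
  rw [tiltRow_dot_corVec]
  unfold tiltCoeff
  rw [if_neg hs]
  simp only [zero_mul, add_zero]
  exact_mod_cast (le_trans (Finset.card_filter_le _ _) (by omega) : meet a b ≤ 1)

theorem tilt_spread_of_two_le (a P : Finset (Fin h)) (hs : 2 ≤ a.card) :
    tiltRow a (tiltCoeff a) ⬝ᵥ qNatG P - tiltRow a (tiltCoeff a) ⬝ᵥ qNatG ∅ = (a.card : ℝ) * (((a ∩ P).card : ℝ) - P.card) := by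
  rw [tiltRow_dot_qNatG, tiltRow_dot_qNatG, Finset.inter_empty, Finset.card_empty, Nat.cast_zero]
  have hs' : (2 : ℝ) ≤ a.card := by exact_mod_cast hs
  have hγ : tiltCoeff a * ((a.card : ℝ) - 1) = -(((a.card : ℝ) - 2) / 2) := by
    unfold tiltCoeff; rw [if_pos hs]
    have : (a.card : ℝ) - 1 ≠ 0 := by linarith
    field_simp
  linear_combination (-2 * ((a ∩ P).card : ℝ)) * hγ

theorem tilt_spread_of_lt_two (a P : Finset (Fin h)) (hs : ¬ 2 ≤ a.card) :
    tiltRow a (tiltCoeff a) ⬝ᵥ qNatG P - tiltRow a (tiltCoeff a) ⬝ᵥ qNatG ∅ = 2 * ((a ∩ P).card : ℝ) - a.card * P.card := by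
  rw [tiltRow_dot_qNatG, tiltRow_dot_qNatG, Finset.inter_empty, Finset.card_empty, Nat.cast_zero]
  have hγ : tiltCoeff a = 0 := by unfold tiltCoeff; rw [if_neg hs]
  rw [hγ]; ring

/-- the pinned rows for `λ•Q♮`: the inner-tilted row of `a ∖ z`, plus `x_zz` when `|a ∖ z| = 1`. -/
noncomputable def pinTilt (z : Fin h) (a : Finset (Fin h)) : Fin h × Fin h → ℝ :=
  tiltRow (a.erase z) (tiltCoeff (a.erase z)) + if (a.erase z).card = 1 then tiltRow ({z} : Finset (Fin h)) 0 else 0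

/-- ★ **`λ•Q♮ ∈ U^pin_1` for every `λ ≥ 0`** (base `q_∅`, any pin): the UDISJ envelope with one pinned coordinate certifies ALL dilates of the
blind cube, on which every fixed clique-row certificate is blind (val-idea-39 g3 `blindPair_hard`, `λ ≥ h − 1`). -/
theorem smul_qNat_udisjThinPin (z : Fin h) (lam : ℝ) (hlam : 0 ≤ lam) :
    UdisjThinPin 1 h (fun P : Finset (Fin h) => lam • qNatG P) := by
  classical
  refine ⟨z, ∅, fun a _ => ⟨pinTilt z a, ⟨fun b hb hab => ?_, fun b hb hab => ?_⟩, fun b P => ?_⟩⟩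
  · have h1 : tiltRow (a.erase z) (tiltCoeff (a.erase z)) ⬝ᵥ corVec (⊤ : SimpleGraph (Fin h)) b = 0 := by
      rw [tiltRow_dot_corVec, meet_erase_of_eq_false a z b hb, hab]; simp
    have h2 : tiltRow ({z} : Finset (Fin h)) 0 ⬝ᵥ corVec (⊤ : SimpleGraph (Fin h)) b = 0 := by
      rw [tiltRow_dot_corVec, meet_singleton_of_eq_false z b hb]; simp
    unfold pinTilt
    split_ifs <;> simp [add_dotProduct, h1, h2]
  · have h1 : tiltRow (a.erase z) (tiltCoeff (a.erase z)) ⬝ᵥ corVec (⊤ : SimpleGraph (Fin h)) b = 1 := by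
      rw [tiltRow_dot_corVec, meet_erase_of_eq_false a z b hb, hab]; simp
    have h2 : tiltRow ({z} : Finset (Fin h)) 0 ⬝ᵥ corVec (⊤ : SimpleGraph (Fin h)) b = 0 := by
      rw [tiltRow_dot_corVec, meet_singleton_of_eq_false z b hb]; simp
    unfold pinTilt
    split_ifs <;> simp [add_dotProduct, h1, h2]
  · have hsplit : ∀ φ : Fin h × Fin h → ℝ,
        φ ⬝ᵥ (corVec (⊤ : SimpleGraph (Fin h)) b + lam • qNatG P - lam • qNatG ∅)
          = φ ⬝ᵥ corVec (⊤ : SimpleGraph (Fin h)) b + lam * (φ ⬝ᵥ qNatG P - φ ⬝ᵥ qNatG ∅) := by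
      intro φ
      rw [add_sub_assoc, dotProduct_add, ← smul_sub, dotProduct_smul, dotProduct_sub, smul_eq_mul]
    have ht' : (((a.erase z) ∩ P).card : ℝ) ≤ P.card := by
      exact_mod_cast Finset.card_le_card Finset.inter_subset_right
    have hzval : tiltRow ({z} : Finset (Fin h)) 0 ⬝ᵥ corVec (⊤ : SimpleGraph (Fin h)) b ≤ 1 := by
      rw [tiltRow_dot_corVec]
      simp only [zero_mul, add_zero]
      exact_mod_cast (le_trans (Finset.card_filter_le _ _) (by simp) : meet ({z} : Finset (Fin h)) b ≤ 1)
    have hzspread : tiltRow ({z} : Finset (Fin h)) 0 ⬝ᵥ qNatG P - tiltRow ({z} : Finset (Fin h)) 0 ⬝ᵥ qNatG ∅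
        = 2 * (((({z} : Finset (Fin h)) ∩ P).card : ℕ) : ℝ) - P.card := by
      rw [tiltRow_dot_qNatG, tiltRow_dot_qNatG, Finset.inter_empty, Finset.card_empty, Nat.cast_zero, Finset.card_singleton]
      push_cast
      ring
    by_cases hs : 2 ≤ (a.erase z).card
    · have hne : (a.erase z).card ≠ 1 := by omega
      have hpin : pinTilt z a = tiltRow (a.erase z) (tiltCoeff (a.erase z)) := by
        unfold pinTilt; rw [if_neg hne, add_zero]
      rw [hpin, hsplit, tilt_spread_of_two_le (a.erase z) P hs]
      have hF := tilt_cor_le_two (a.erase z) b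
      have hs0 : (0 : ℝ) ≤ (a.erase z).card := Nat.cast_nonneg _
      have hprod : lam * (((a.erase z).card : ℝ) * ((((a.erase z) ∩ P).card : ℝ) - P.card)) ≤ 0 :=
        mul_nonpos_of_nonneg_of_nonpos hlam (mul_nonpos_of_nonneg_of_nonpos hs0 (by linarith))
      linarith
    · by_cases h1 : (a.erase z).card = 1
      · have hpin : pinTilt z a = tiltRow (a.erase z) (tiltCoeff (a.erase z)) + tiltRow ({z} : Finset (Fin h)) 0 := by
          unfold pinTilt; rw [if_pos h1]
        rw [hpin, add_dotProduct, hsplit, hsplit, tilt_spread_of_lt_two (a.erase z) P hs, hzspread, h1]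
        have hF := tilt_cor_le_one (a.erase z) b hs
        have hdisj : ((((a.erase z) ∩ P).card : ℕ) : ℝ) + (((({z} : Finset (Fin h)) ∩ P).card : ℕ) : ℝ) ≤ P.card := by
          have hsub : (a.erase z) ∩ P ∪ ({z} : Finset (Fin h)) ∩ P ⊆ P :=
            Finset.union_subset Finset.inter_subset_right Finset.inter_subset_right
          have hcard := Finset.card_le_card hsub
          rw [Finset.card_union_of_disjoint] at hcard
          · exact_mod_cast hcard
          · exact Finset.disjoint_left.2 fun i hi hi' => by
              simp only [Finset.mem_inter, Finset.mem_erase, Finset.mem_singleton] at hi hi'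
              exact hi.1.1 hi'.1
        push_cast
        nlinarith [hzval, hF, hdisj, hlam]
      · have h0 : (a.erase z).card = 0 := by omega
        have hpin : pinTilt z a = tiltRow (a.erase z) (tiltCoeff (a.erase z)) := by
          unfold pinTilt; rw [if_neg h1, add_zero]
        rw [hpin, hsplit, tilt_spread_of_lt_two (a.erase z) P hs, h0]
        have hF := tilt_cor_le_one (a.erase z) b hs
        have ht0 : (((a.erase z) ∩ P).card : ℝ) = 0 := by
          rw [Finset.card_eq_zero.1 h0]; simp
        rw [ht0]
        push_cast
        nlinarith [hF, hlam]

/-- ★ corollary: `COR(K_{n+1}) + λ•Q♮` is decided for every `λ ≥ 0` modulo the matrix-level stub. -/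
theorem smul_qNat_decided (hU : UdisjShiftRankHard) :
    ∀ c : ℕ, ∃ n₀ : ℕ, ∀ n ≥ n₀, ∀ (lam : ℝ), 0 ≤ lam → ∀ r : ℕ,
      HasEFOfSize (corPolytopeGraph (⊤ : SimpleGraph (Fin (n + 1))) +
        convexHull ℝ (Set.range fun P : Finset (Fin (n + 1)) => lam • qNatG P)) r → T c (n + 1) < r := by
  intro c
  obtain ⟨n₀, hn₀⟩ := udisjThinPin_decided hU c
  refine ⟨max n₀ 1, fun n hn lam hlam r hEF => hn₀ n (le_trans (le_max_left _ _) hn) _ _ r ?_ hEF⟩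
  have hpin := smul_qNat_udisjThinPin (h := n + 1) 0 lam hlam
  obtain ⟨z, j₀, hz⟩ := hpin
  refine ⟨z, j₀, fun a ha => ?_⟩
  obtain ⟨φ, hφ, hval⟩ := hz a ha
  refine ⟨φ, hφ, fun b j => le_trans (hval b j) ?_⟩
  have h1 : 1 ≤ n := le_trans (le_max_right _ _) hn
  have : 1 ≤ Nat.sqrt (Nat.sqrt n) := by rw [Nat.le_sqrt, Nat.le_sqrt]; simpa using h1
  have : (1 : ℝ) ≤ Nat.sqrt (Nat.sqrt n) := by exact_mod_cast this
  linarith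

/-! ## §6 (crit-9 V#32 optional price P-P1f) `Q♮ ∉ S` in the kernel: the blind cube is NOT clique-shallow -/

/-- the clique-row value on the blind cube: `udRow_a(q_P) = −|a|(|a| + |P| − 2|a∩P|)` (= val-idea-39 g3's `udRow_dotProduct_qNat`, graph currency). -/
theorem cliqueRowG_dot_qNatG (a P : Finset (Fin h)) :
    cliqueRowG a ⬝ᵥ qNatG P = -((a.card : ℝ) * (a.card + P.card - 2 * ((a ∩ P).card : ℝ))) := by
  rw [cliqueRowG_eq_tiltRow, tiltRow_dot_qNatG]; ring

theorem four_mul_sqrt_succ_le (hh : 24 ≤ h) : 4 * (Nat.sqrt h + 1) ≤ h := by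
  have h3 := Nat.sqrt_le h
  have h4 := Nat.lt_succ_sqrt h
  generalize hr : Nat.sqrt h = r at h3 h4 ⊢
  by_cases h5 : 5 ≤ r
  · nlinarith
  · push Not at h5
    interval_cases r <;> omega

/-- ★ P-P1f: **`Q♮ ∉ S`** (indeed no generator is within `⌊⌊√h⌋^{1/2}⌋` of the maximum of every CLIQUE row; `h ≥ 24` for a clean margin):
above `q_{P₀}` the row `P₀ᶜ` climbs by `|P₀ᶜ|·h` (if `2|P₀| ≤ h`), else a half `a ⊆ P₀` climbs by `|a|(|P₀| − |a|)`.  With §3 this places the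
blind cube in `U₁ ∖ S` (S ⊆ U by §4). -/
theorem qNat_not_cliqueShallow (hh : 24 ≤ h) :
    ¬ ∃ P₀ : Finset (Fin h), ∀ (a P : Finset (Fin h)),
        cliqueRowG a ⬝ᵥ qNatG P ≤ cliqueRowG a ⬝ᵥ qNatG P₀ + Nat.sqrt (Nat.sqrt h) := by
  classical
  rintro ⟨P₀, hP₀⟩
  have hτ : ((Nat.sqrt (Nat.sqrt h) : ℕ) : ℝ) + 1 ≤ (h : ℝ) / 4 := by
    have h1 : ((Nat.sqrt (Nat.sqrt h) : ℕ) : ℝ) ≤ Nat.sqrt h := by exact_mod_cast Nat.sqrt_le_self _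
    have h2 : (4 : ℝ) * ((Nat.sqrt h : ℝ) + 1) ≤ h := by exact_mod_cast four_mul_sqrt_succ_le hh
    linarith
  have hh' : (24 : ℝ) ≤ h := by exact_mod_cast hh
  have hp₀h : P₀.card ≤ h := by simpa using Finset.card_le_univ P₀
  by_cases hp : 2 * P₀.card ≤ h
  · have key := hP₀ P₀ᶜ P₀ᶜ
    rw [cliqueRowG_dot_qNatG, cliqueRowG_dot_qNatG, Finset.inter_self, Finset.inter_comm, Finset.inter_compl,
      Finset.card_empty, Finset.card_compl, Fintype.card_fin, Nat.cast_sub hp₀h, Nat.cast_zero] at key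
    have hp' : (2 : ℝ) * P₀.card ≤ h := by exact_mod_cast hp
    have hs : (h : ℝ) / 2 ≤ (h : ℝ) - P₀.card := by linarith
    nlinarith [mul_le_mul_of_nonneg_right hs (by linarith : (0 : ℝ) ≤ h)]
  · push Not at hp
    obtain ⟨a, haP, hacard⟩ := Finset.exists_subset_card_eq (s := P₀) (n := P₀.card / 2) (Nat.div_le_self _ _)
    have key := hP₀ a a
    rw [cliqueRowG_dot_qNatG, cliqueRowG_dot_qNatG, Finset.inter_self, Finset.inter_eq_left.2 haP, hacard] at key
    have hs1 : 2 * (P₀.card / 2) ≤ P₀.card := Nat.mul_div_le _ _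
    have hs2 : P₀.card ≤ 2 * (P₀.card / 2) + 1 := by omega
    have hs1' : (2 : ℝ) * (P₀.card / 2 : ℕ) ≤ P₀.card := by exact_mod_cast hs1
    have hs2' : (P₀.card : ℝ) ≤ 2 * (P₀.card / 2 : ℕ) + 1 := by exact_mod_cast hs2
    have hp' : (h : ℝ) + 1 ≤ 2 * P₀.card := by exact_mod_cast hp
    have hsl : ((h : ℝ) - 1) / 4 ≤ (P₀.card / 2 : ℕ) := by linarith
    have hps : ((h : ℝ) - 1) / 4 ≤ (P₀.card : ℝ) - (P₀.card / 2 : ℕ) := by linarith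
    have hprod := mul_le_mul hsl hps (by linarith) (by linarith)
    nlinarith [hprod, sq_nonneg ((h : ℝ) - 3)]

/-! ## §7 PORT KIT (pen val-idea-42 g2 rev-16 plan (3); crit-9 LIST outlook (d)) — BFPS12 Thm 5 as the PRIMITIVE named fact; Thm 6 and this
file's stub DERIVED from it

Planners do not propose Literature files; this section is Literature-style TEXT, farm-checked here, for lit g17 / val-port-3 to lift into
`Literature/Combinatorics/Optimization/CorPolytopeApproximateEFLowerBound.lean`: (a) `BFPS2012_udisjShiftRankHard` = Thm 5 second clause
(MATRIX level: nonnegative ρ-extensions of UDISJ, `β < 1/2`), typed in the exact style of port-3's `BFPS2012_corSandwichHard`; (b) ★`corSandwichHard_of_bfps5 :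
BFPS2012_udisjShiftRankHard → BFPS2012_corSandwichHard` — Thm 6 (second clause) becomes a THEOREM over the primitive fact (print proof p. 13:
Thm 1 = Yannakakis for pairs = tree `HasEFOfSize.exists_nonneg_factorization`, + Thm 5; the affine `+1` slot is absorbed by halving the constant);
(c) ★`udisjShiftRankHard_of_bfps5 : BFPS2012_udisjShiftRankHard → UdisjShiftRankHard` — this file's KNOWN stub (§1) discharged BY NAME, so §2/§5
(`udisjThin_decided`, `udisjThinPin_decided`, `smul_qNat_decided`) hold over the ONE primitive fact, and the line can admit `¬ UdisjThin` with a FACT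
binder `(hB5 : BFPS2012_udisjShiftRankHard)` (the pen's condition (3)), never a 4th sorry. -/

section PortKit

open Literature.Combinatorics.Optimization (corCliqueMat corOuter mem_corOuter BFPS2012_corSandwichHard
  one_sub_flat_corCliqueMat_dotProduct_vecOuter)
open Literature.Combinatorics.Optimization.FixedSizePsdRank (Cube bvec vecOuter flat corPolytope ip udisj)
open Summit.ValiantsHypothesis.ValiantsHypothesis.Theorems.FifoMatching.CorSandwich (threshold_lt_of_rpow_bound rho_le)

/-- (a) **Braun–Fiorini–Pokutta–Steurer 2012, Theorem 5 (second clause) — nonnegative rank of UDISJ shifts, MATRIX LEVEL; proposed PRIMITIVE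
named fact.**  «Let `M ∈ ℝ₊^{2ⁿ×2ⁿ}` (rows and columns indexed by `{0,1}ⁿ`) be a `ρ`-extension of UDISJ: `M_ab = ρ` whenever `|a ∩ b| = 0` and
`M_ab = ρ − 1` whenever `|a ∩ b| = 1` (other entries arbitrary nonnegative).  If `ρ = O(n^β)` for some constant `β < 1/2` then
`rank₊(M) = 2^{Ω(n^{1−2β})}`.»  Constants existential as printed: for every `β ∈ [0, 1/2)` and `C > 0` there are `c > 0` and `n₀` such that for
`n ≥ n₀`, `1 ≤ ρ ≤ C·n^β`, every nonnegative factorisation of such an `M` through a finite slot type `S` has `2^{c·n^{1−2β}} ≤ |S|`.  NOT proved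
(print: Razborov's rectangle-corruption lemma = their Lemma 5, pp. 8–11, + the half-page estimate p. 12; port size L).
[cite: BraunEtAl2012, Thm 5 (§3.2, pp. 11–12); arXiv:1204.0957] -/
def BFPS2012_udisjShiftRankHard : Prop :=
  ∀ β : ℝ, 0 ≤ β → β < 1 / 2 → ∀ C : ℝ, 0 < C →
    ∃ c : ℝ, 0 < c ∧ ∃ n₀ : ℕ, ∀ n : ℕ, n₀ ≤ n → ∀ ρ : ℝ, 1 ≤ ρ → ρ ≤ C * (n : ℝ) ^ β →
      ∀ M : Cube n → Cube n → ℝ, (∀ a b, 0 ≤ M a b) →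
        (∀ a b, ip a b = 0 → M a b = ρ) → (∀ a b, ip a b = 1 → M a b = ρ - 1) →
        ∀ (S : Type) [Fintype S] (U : Cube n → S → ℝ) (V : Cube n → S → ℝ),
          (∀ a i, 0 ≤ U a i) → (∀ b i, 0 ≤ V b i) → (∀ a b, M a b = ∑ i, U a i * V b i) →
          (2 : ℝ) ^ (c * (n : ℝ) ^ (1 - 2 * β)) ≤ Fintype.card S

/-- halving the constant absorbs the affine slot: `2^{c·x} ≤ r + 1` with `c·x ≥ 2` gives `2^{(c/2)·x} ≤ r`. -/
theorem rpow_half_le_of_le_succ {c x : ℝ} {r : ℕ} (hcx : 2 ≤ c * x) (h : (2 : ℝ) ^ (c * x) ≤ r + 1) :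
    (2 : ℝ) ^ (c / 2 * x) ≤ r := by
  have hsplit : (2 : ℝ) ^ (c * x) = (2 : ℝ) ^ (c / 2 * x) * (2 : ℝ) ^ (c / 2 * x) := by
    rw [← Real.rpow_add (by norm_num : (0 : ℝ) < 2)]; ring_nf
  have h2 : (2 : ℝ) ≤ (2 : ℝ) ^ (c / 2 * x) := by
    calc (2 : ℝ) = (2 : ℝ) ^ (1 : ℝ) := (Real.rpow_one 2).symm
      _ ≤ (2 : ℝ) ^ (c / 2 * x) := Real.rpow_le_rpow_of_exponent_le (by norm_num) (by linarith)
  set y := (2 : ℝ) ^ (c / 2 * x) with hy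
  have hyy : y * y ≤ r + 1 := by rw [← hsplit]; exact h
  have h2y : 2 * y ≤ y * y := by nlinarith
  have hr : (3 : ℝ) ≤ r := by nlinarith
  nlinarith

/-- eventually `2 ≤ c·n^γ` (`c, γ > 0`). -/
theorem two_le_mul_rpow_eventually {c γ : ℝ} (hc : 0 < c) (hγ : 0 < γ) :
    ∃ N : ℕ, ∀ n : ℕ, N ≤ n → 2 ≤ c * (n : ℝ) ^ γ := by
  refine ⟨⌈(2 / c) ^ γ⁻¹⌉₊, fun n hn => ?_⟩
  have hle : (2 / c) ^ γ⁻¹ ≤ (n : ℝ) := le_trans (Nat.le_ceil _) (by exact_mod_cast hn)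
  have hroot : ((2 / c) ^ γ⁻¹) ^ γ ≤ (n : ℝ) ^ γ := Real.rpow_le_rpow (by positivity) hle hγ.le
  rw [Real.rpow_inv_rpow (by positivity) hγ.ne'] at hroot
  have hcc : c * (2 / c) = 2 := by field_simp
  have := mul_le_mul_of_nonneg_left hroot hc.le
  rwa [hcc] at this

/-- (b) ★ **Theorem 6 (second clause) FROM Theorem 5** — port-3's named fact `BFPS2012_corSandwichHard` is a theorem over the primitive one:
the clique inequalities `⟨2·diag(a) − aaᵀ, x⟩ ≤ ρ` are valid on `K ⊆ ρ·Q(n)`, the vertices `bbᵀ ∈ COR(n) ⊆ K`, so an EF of `K` with `r`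
inequalities factorises the slack `ρ − ⟨2·diag(a) − aaᵀ, bbᵀ⟩ = ρ − 1 + (1 − aᵀb)²` — a nonnegative `ρ`-extension of UDISJ — through `r + 1`
slots (Thm 1 / Yannakakis, tree `HasEFOfSize.exists_nonneg_factorization`); Thm 5 gives `2^{c n^{1−2β}} ≤ r + 1`, hence `2^{(c/2) n^{1−2β}} ≤ r`.
[cite: BraunEtAl2012, Thm 6 ⇐ Thm 1 + Thm 5 (§4.1, p. 13)] -/
theorem corSandwichHard_of_bfps5 (h5 : BFPS2012_udisjShiftRankHard) : BFPS2012_corSandwichHard := by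
  classical
  intro β hβ0 hβ C hC
  obtain ⟨c, hc, n₀, hn₀⟩ := h5 β hβ0 hβ C hC
  have hγ : 0 < 1 - 2 * β := by linarith
  obtain ⟨N, hN⟩ := two_le_mul_rpow_eventually hc hγ
  refine ⟨c / 2, by positivity, max n₀ N, fun n hn ρ hρ1 hρC K r hP hQ hEF => ?_⟩
  have hn₀' : n₀ ≤ n := le_trans (le_max_left _ _) hn
  have hN' : N ≤ n := le_trans (le_max_right _ _) hn
  have hv : ∀ b : Cube n, vecOuter n (bvec b) ∈ K := fun b => hP (subset_convexHull ℝ _ ⟨b, rfl⟩)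
  have hvalid : ∀ a : Cube n, ∀ x ∈ K, flat (corCliqueMat a) ⬝ᵥ x ≤ ρ := fun a x hx => (mem_corOuter.1 (hQ hx)) a
  obtain ⟨U, V, hU0, hV0, hfac⟩ :=
    Literature.Barriers.PneNP.HasEFOfSize.exists_nonneg_factorization hEF (fun b : Cube n => vecOuter n (bvec b)) hv
      (fun a : Cube n => flat (corCliqueMat a)) (fun _ => ρ) hvalid
  have hM : ∀ a b : Cube n, ρ - flat (corCliqueMat a) ⬝ᵥ vecOuter n (bvec b) = ρ - 1 + udisj n a b := by
    intro a b; rw [← one_sub_flat_corCliqueMat_dotProduct_vecOuter]; ring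
  have hud : ∀ a b : Cube n, 0 ≤ udisj n a b := fun a b => sq_nonneg _
  have key := hn₀ n hn₀' ρ hρ1 hρC (fun a b => ρ - flat (corCliqueMat a) ⬝ᵥ vecOuter n (bvec b))
    (fun a b => by rw [hM]; linarith [hud a b])
    (fun a b hab => by rw [hM]; simp [udisj, hab])
    (fun a b hab => by rw [hM]; simp [udisj, hab])
    (Option (Fin r)) U V hU0 hV0 (fun a b => hfac a b)
  rw [Fintype.card_option, Fintype.card_fin] at key
  push_cast at key
  exact rpow_half_le_of_le_succ (hN n hN') key

/-- (c) ★ **this file's KNOWN stub from Theorem 5** (`β = 1/4`, `C = 2`, quasi-polynomial threshold): rows re-indexed from subsets to 0/1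
vectors (`meet (supp a) b = ip a b`), `ρ ≤ 1 + ⌊⌊√n⌋^{1/2}⌋ ≤ 2 n^{1/4}` (`CorSandwich.rho_le`), `2^{c√n} ≤ r + 1 ⇒ 2^{n^{1/4}} ≤ r`
eventually, and the route threshold `2^((log₂ n + c₀)^{c₀}) < r` by `CorSandwich.threshold_lt_of_rpow_bound`.  With it, §2/§5 read
`udisjThin_decided (udisjShiftRankHard_of_bfps5 hB5)` etc. over the ONE primitive fact. -/
theorem udisjShiftRankHard_of_bfps5 (h5 : BFPS2012_udisjShiftRankHard) : UdisjShiftRankHard := by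
  classical
  intro c₀
  obtain ⟨c, hc, n₁, hn₁⟩ := h5 (1 / 4) (by norm_num) (by norm_num) 2 (by norm_num)
  obtain ⟨h₀, hh₀⟩ := threshold_lt_of_rpow_bound c₀ (c₃ := 1 / 4) (by norm_num)
  obtain ⟨N, hN⟩ := two_le_mul_rpow_eventually hc (by norm_num : (0 : ℝ) < 1 / 4)
  refine ⟨max (max n₁ h₀) (max N 1), fun n hn ρ hρ1 hρ M hM0 hMρ hMρ1 r U V hU0 hV0 hfac => ?_⟩
  have hn₁' : n₁ ≤ n := le_trans (le_trans (le_max_left _ _) (le_max_left _ _)) hn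
  have hh₀' : h₀ ≤ n := le_trans (le_trans (le_max_right _ _) (le_max_left _ _)) hn
  have hN' : N ≤ n := le_trans (le_trans (le_max_left _ _) (le_max_right _ _)) hn
  have hn1 : 1 ≤ n := le_trans (le_trans (le_max_right _ _) (le_max_right _ _)) hn
  obtain ⟨s, hs⟩ : ∃ s : Cube n → Finset (Fin n), ∀ a b, meet (s a) b = ip a b :=
    ⟨fun a => Finset.univ.filter fun i => a i = true, fun a b => by simp only [meet, ip, Finset.filter_filter]⟩
  have key := hn₁ n hn₁' ρ hρ1 (le_trans hρ (rho_le hn1)) (fun a b => M (s a) b) (fun a b => hM0 _ _)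
    (fun a b hab => hMρ _ _ (by rw [hs]; exact hab)) (fun a b hab => hMρ1 _ _ (by rw [hs]; exact hab))
    (Option (Fin r)) (fun a i => U (s a) i) V (fun a i => hU0 _ _) hV0 (fun a b => hfac _ _)
  rw [Fintype.card_option, Fintype.card_fin] at key
  push_cast at key
  norm_num at key
  -- key : 2 ^ (c * n ^ (1/2)) ≤ r + 1 ; get 2 ^ (2 * n ^ (1/4)) ≤ r + 1, then 2 ^ (n ^ (1/4)) ≤ r
  have hnpos : (0 : ℝ) < n := by exact_mod_cast hn1
  have hq0 : (0 : ℝ) ≤ (n : ℝ) ^ (1 / 4 : ℝ) := by positivity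
  have hq1 : (1 : ℝ) ≤ (n : ℝ) ^ (1 / 4 : ℝ) := Real.one_le_rpow (by exact_mod_cast hn1) (by norm_num)
  have hexp : 2 * (n : ℝ) ^ (1 / 4 : ℝ) ≤ c * (n : ℝ) ^ (1 / 2 : ℝ) := by
    have hsplit : (n : ℝ) ^ (1 / 2 : ℝ) = (n : ℝ) ^ (1 / 4 : ℝ) * (n : ℝ) ^ (1 / 4 : ℝ) := by
      rw [← Real.rpow_add hnpos]; norm_num
    rw [hsplit, ← mul_assoc]
    exact mul_le_mul_of_nonneg_right (hN n hN') hq0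
  have h2 : (2 : ℝ) ^ (2 * (n : ℝ) ^ (1 / 4 : ℝ)) ≤ r + 1 :=
    le_trans (Real.rpow_le_rpow_of_exponent_le (by norm_num) hexp) key
  have h3 := rpow_half_le_of_le_succ (by linarith) h2
  norm_num at h3
  exact hh₀ n hh₀' r h3

/-- ★ the pen's intake shape: CLASS U decided over the ONE primitive Literature-style fact (no sorry anywhere in the chain). -/
theorem udisjThin_decided_of_bfps5 (hB5 : BFPS2012_udisjShiftRankHard) :
    ∀ c : ℕ, ∃ h₀ : ℕ, ∀ h ≥ h₀, ∀ (K : ℕ) (q : Fin (K + 1) → (Fin h × Fin h → ℝ)) (r : ℕ),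
      UdisjThin (Nat.sqrt (Nat.sqrt h)) h q →
      HasEFOfSize (corPolytopeGraph (⊤ : SimpleGraph (Fin h)) + convexHull ℝ (Set.range q)) r → T c h < r :=
  udisjThin_decided (udisjShiftRankHard_of_bfps5 hB5)

/-- ★ same for the pinned envelope (hence for every dilate `λ•Q♮`, `smul_qNat_decided (udisjShiftRankHard_of_bfps5 hB5)`). -/
theorem udisjThinPin_decided_of_bfps5 (hB5 : BFPS2012_udisjShiftRankHard) :
    ∀ c : ℕ, ∃ n₀ : ℕ, ∀ n ≥ n₀, ∀ (J : Type) (q : J → (Fin (n + 1) × Fin (n + 1) → ℝ)) (r : ℕ),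
      UdisjThinPin (Nat.sqrt (Nat.sqrt n)) (n + 1) q →
      HasEFOfSize (corPolytopeGraph (⊤ : SimpleGraph (Fin (n + 1))) + convexHull ℝ (Set.range q)) r → T c (n + 1) < r :=
  udisjThinPin_decided (udisjShiftRankHard_of_bfps5 hB5)

end PortKit

end Summit.ValiantsHypothesis.ValiantsHypothesis.Cruxes.NNDivisionHard.UdisjEnvelope
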